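import Mathlib.Analysis.Calculus.FDeriv.Analytic
import Mathlib.Analysis.Analytic.IteratedFDeriv
import Mathlib.LinearAlgebra.Multilinear.Basis
import Mathlib.Analysis.Calculus.ContDiff.Basic
import HarnessLib

/-!
# Analytic flatness: families closed under directional derivatives and vanishing at a point

Family `periods` (periods.S27), topic `Literature/Analysis/Calculus`: an analytic lemma used in
Wilkie's desingularisation theorem (den Besten, *Wilkie's Theorem and the Uniform Real Schanuel
Conjecture*, MSc thesis (2016), Lemma 3.1.6 — "a finitely generated ideal of germs closed under
differentiation, whose generators vanish at `P`, consists of germs vanishing on a neighbourhood of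
`P`"; there for definable `C^∞` germs in an o-minimal structure, here for real-analytic functions).

**`eventuallyEq_zero_of_mem_of_closed_dirDeriv`** (and the primed variants, where closure under
directional derivatives is only required up to equality on `U`): let `U ⊆ E` be open (`E` a finite-dimensional
real normed space with a basis `b`), `x ∈ U`, and `𝓘` a family of functions `E → F`, analytic on
`U`, closed under the directional derivatives `g ↦ ∂_{b i} g` and all vanishing at `x`. Then every
member of `𝓘` vanishes on a neighbourhood of `x`.

*Proof.* By induction on `n`, every `n`-th iterated derivative of every `g ∈ 𝓘` vanishes at `x` on
tuples of basis vectors (`iteratedFDerivWithin_succ_apply_right`: `D^{n+1}g(x)(m, v) =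
D^n(∂_v g)(x)(m)`), hence vanishes identically (multilinearity, `Module.Basis.ext_multilinear`);
an analytic function is the sum of its Taylor series (`HasFPowerSeriesOnBall.hasSum_iteratedFDeriv`).

## References

* M. den Besten, *Wilkie's Theorem and the Uniform Real Schanuel Conjecture*, MSc thesis, Utrecht
  (2016), Lemma 3.1.6.
* A. J. Wilkie, *Model completeness results for expansions of the ordered field of real numbers …*,
  J. Amer. Math. Soc. 9 (1996).
-/

noncomputable section

open scoped Topology
open Set Filter

namespace Literature.Analysis.Calculus

variable {E : Type*} [NormedAddCommGroup E] [NormedSpace ℝ E]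
  {F : Type*} [NormedAddCommGroup F] [NormedSpace ℝ F]

/-- The directional derivative `∂_v g : y ↦ Dg(y) v` as a function. [folklore] -/
def dirDeriv (v : E) (g : E → F) : E → F := fun y => fderiv ℝ g y v

/-- `∂_v g (y) = Dg(y) v`. [folklore] -/
@[simp] theorem dirDeriv_apply (v : E) (g : E → F) (y : E) : dirDeriv v g y = fderiv ℝ g y v := rfl

variable [CompleteSpace F]

/-- **Iterated derivatives on basis tuples of a family closed (up to equality on `U`) under
directional derivatives and vanishing at `x` all vanish at `x`.** [folklore] -/
theorem iteratedFDerivWithin_apply_basis_eq_zero' {ι : Type*} (b : Module.Basis ι ℝ E) {U : Set E}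
    (hU : IsOpen U) {x : E} (hx : x ∈ U) (𝓘 : Set (E → F))
    (han : ∀ g ∈ 𝓘, AnalyticOnNhd ℝ g U) (hcl : ∀ g ∈ 𝓘, ∀ i, ∃ g' ∈ 𝓘, EqOn (dirDeriv (b i) g) g' U)
    (h0 : ∀ g ∈ 𝓘, g x = 0) :
    ∀ (n : ℕ) (g : E → F), g ∈ 𝓘 → ∀ w : Fin n → ι,
      iteratedFDerivWithin ℝ n g U x (fun k => b (w k)) = 0 := by
  intro n
  induction n with
  | zero => intro g hg w; rw [iteratedFDerivWithin_zero_apply]; exact h0 g hg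
  | succ n ih =>
    intro g hg w
    have hsmooth : ContDiffOn ℝ ⊤ g U := fun y hy => ((han g hg y hy).contDiffAt).contDiffWithinAt
    rw [iteratedFDerivWithin_succ_apply_right (hU.uniqueDiffOn) hx]
    -- `y ↦ fderivWithin g U y` is smooth on `U`, and on `U` it is `fderiv`
    have hc : ContDiffOn ℝ ⊤ (fun y => fderivWithin ℝ g U y) U :=
      hsmooth.fderivWithin hU.uniqueDiffOn (by simp)
    have happly := iteratedFDerivWithin_clm_apply_const_apply (𝕜 := ℝ) hU.uniqueDiffOn hc
      (i := n) (by exact_mod_cast le_top) hx (u := b (w (Fin.last n))) (m := Fin.init fun k => b (w k))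
    obtain ⟨g', hg', hgg'⟩ := hcl g hg (w (Fin.last n))
    -- the function `y ↦ fderivWithin g U y (b (w last))` agrees with `g'` on `U`
    have heq : EqOn (fun y => fderivWithin ℝ g U y (b (w (Fin.last n)))) g' U :=
      fun y hy => by simp only [← hgg' hy, dirDeriv_apply]; rw [fderivWithin_of_isOpen hU hy]
    have hgoal : iteratedFDerivWithin ℝ n (fun y => fderivWithin ℝ g U y) U x (Fin.init fun k => b (w k))
        (b (w (Fin.last n))) = 0 := by
      rw [← happly, iteratedFDerivWithin_congr heq hx]
      exact ih _ hg' fun k => w (Fin.castSucc k)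
    exact hgoal

/-- **Iterated derivatives on basis tuples of a family closed under directional derivatives and
vanishing at `x` all vanish at `x`.** [folklore] -/
theorem iteratedFDerivWithin_apply_basis_eq_zero {ι : Type*} (b : Module.Basis ι ℝ E) {U : Set E}
    (hU : IsOpen U) {x : E} (hx : x ∈ U) (𝓘 : Set (E → F))
    (han : ∀ g ∈ 𝓘, AnalyticOnNhd ℝ g U) (hcl : ∀ g ∈ 𝓘, ∀ i, dirDeriv (b i) g ∈ 𝓘)
    (h0 : ∀ g ∈ 𝓘, g x = 0) :
    ∀ (n : ℕ) (g : E → F), g ∈ 𝓘 → ∀ w : Fin n → ι,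
      iteratedFDerivWithin ℝ n g U x (fun k => b (w k)) = 0 :=
  iteratedFDerivWithin_apply_basis_eq_zero' b hU hx 𝓘 han
    (fun g hg i => ⟨_, hcl g hg i, fun _ _ => rfl⟩) h0

/-- **All iterated derivatives at `x` of such a family vanish** (closure up to equality on `U`). [folklore] -/
theorem iteratedFDeriv_eq_zero' {ι : Type*} [Finite ι] (b : Module.Basis ι ℝ E) {U : Set E}
    (hU : IsOpen U) {x : E} (hx : x ∈ U) (𝓘 : Set (E → F))
    (han : ∀ g ∈ 𝓘, AnalyticOnNhd ℝ g U) (hcl : ∀ g ∈ 𝓘, ∀ i, ∃ g' ∈ 𝓘, EqOn (dirDeriv (b i) g) g' U)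
    (h0 : ∀ g ∈ 𝓘, g x = 0) {g : E → F} (hg : g ∈ 𝓘) (n : ℕ) :
    iteratedFDeriv ℝ n g x = 0 := by
  rw [← iteratedFDerivWithin_of_isOpen n hU hx]
  have h : (iteratedFDerivWithin ℝ n g U x).toMultilinearMap = (0 : ContinuousMultilinearMap ℝ (fun _ : Fin n => E) F).toMultilinearMap := by
    refine Module.Basis.ext_multilinear (fun _ => b) fun w => ?_
    exact iteratedFDerivWithin_apply_basis_eq_zero' b hU hx 𝓘 han hcl h0 n g hg w
  exact ContinuousMultilinearMap.toMultilinearMap_injective h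

/-- **Analytic flatness, closure up to equality on `U`** (den Besten 2016, Lemma 3.1.6,
real-analytic version): every member of a family of functions analytic on an open `U ∋ x`, closed
on `U` under the directional derivatives along a basis and vanishing at `x`, vanishes on a
neighbourhood of `x`. [cite: denBesten2016, Lemma 3.1.6 (real-analytic case)] -/
theorem eventuallyEq_zero_of_mem_of_closed_dirDeriv' {ι : Type*} [Finite ι] (b : Module.Basis ι ℝ E)
    {U : Set E} (hU : IsOpen U) {x : E} (hx : x ∈ U) (𝓘 : Set (E → F))
    (han : ∀ g ∈ 𝓘, AnalyticOnNhd ℝ g U) (hcl : ∀ g ∈ 𝓘, ∀ i, ∃ g' ∈ 𝓘, EqOn (dirDeriv (b i) g) g' U)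
    (h0 : ∀ g ∈ 𝓘, g x = 0) {g : E → F} (hg : g ∈ 𝓘) : g =ᶠ[𝓝 x] 0 := by
  obtain ⟨p, r, hp⟩ := han g hg x hx
  -- on the ball of convergence, `g (x + y) = Σ (n!)⁻¹ Dⁿg(x)(y,…,y) = 0`
  have hzero : ∀ y ∈ Metric.eball (0 : E) r, g (x + y) = 0 := fun y hy => by
    have h := hp.hasSum_iteratedFDeriv hy
    simp only [iteratedFDeriv_eq_zero' b hU hx 𝓘 han hcl h0 hg, zero_apply, smul_zero] at h
    exact h.unique hasSum_zero
  have hball : Metric.eball x r ∈ 𝓝 x := Metric.eball_mem_nhds x hp.r_pos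
  filter_upwards [hball] with y hy
  have : y - x ∈ Metric.eball (0 : E) r := by
    rw [Metric.mem_eball, edist_zero_right, ← edist_eq_enorm_sub]; exact hy
  simpa using hzero (y - x) this

/-- **All iterated derivatives at `x` of such a family vanish.** [folklore] -/
theorem iteratedFDeriv_eq_zero {ι : Type*} [Finite ι] (b : Module.Basis ι ℝ E) {U : Set E}
    (hU : IsOpen U) {x : E} (hx : x ∈ U) (𝓘 : Set (E → F))
    (han : ∀ g ∈ 𝓘, AnalyticOnNhd ℝ g U) (hcl : ∀ g ∈ 𝓘, ∀ i, dirDeriv (b i) g ∈ 𝓘)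
    (h0 : ∀ g ∈ 𝓘, g x = 0) {g : E → F} (hg : g ∈ 𝓘) (n : ℕ) :
    iteratedFDeriv ℝ n g x = 0 :=
  iteratedFDeriv_eq_zero' b hU hx 𝓘 han (fun g hg i => ⟨_, hcl g hg i, fun _ _ => rfl⟩) h0 hg n

/-- **Analytic flatness** (den Besten 2016, Lemma 3.1.6, real-analytic version): every member of a
family of functions analytic on an open `U ∋ x`, closed under the directional derivatives along a
basis and vanishing at `x`, vanishes on a neighbourhood of `x`. [cite: denBesten2016, Lemma 3.1.6 (real-analytic case)] -/
theorem eventuallyEq_zero_of_mem_of_closed_dirDeriv {ι : Type*} [Finite ι] (b : Module.Basis ι ℝ E)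
    {U : Set E} (hU : IsOpen U) {x : E} (hx : x ∈ U) (𝓘 : Set (E → F))
    (han : ∀ g ∈ 𝓘, AnalyticOnNhd ℝ g U) (hcl : ∀ g ∈ 𝓘, ∀ i, dirDeriv (b i) g ∈ 𝓘)
    (h0 : ∀ g ∈ 𝓘, g x = 0) {g : E → F} (hg : g ∈ 𝓘) : g =ᶠ[𝓝 x] 0 :=
  eventuallyEq_zero_of_mem_of_closed_dirDeriv' b hU hx 𝓘 han (fun g hg i => ⟨_, hcl g hg i, fun _ _ => rfl⟩) h0 hg

end Literature.Analysis.Calculus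

end
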